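import Summits.Langlands.Langlands.Theses.DyadicOddResidue
import Summits.Langlands.Langlands.Theorems.DyadicOddResidueDyadicNonsolvableFM
import Literature.NumberTheory.Automorphic.FontaineMazurGL2DyadicNonsolvable
import Literature.NumberTheory.Automorphic.SerreConjecture
import HarnessLib

/-!
# Skeleton of line `Sketch` (crux stmt-Langlands-18744, `DyadicOddResidue.DyadicNonsolvableFM`)
# — revision 5 (continuation lead c2, 2026-08-17): composition over the LANDED files,
# second fact stub WEAKENED to the weak form of Serre's conjecture at `2` (obligation landed p165263)

The route decl `Summit.Langlands.Langlands.Theses.DyadicOddResidue.DyadicNonsolvableFM` is the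
Fontaine–Mazur conjecture for `GL₂/ℚ` at the prime `ℓ = 2` in the regular case for residual
representations that are absolutely irreducible with NON-SOLVABLE image, in the summit's
automorphic `L`-normalisation.  It is a PRINTED THEOREM: Tung, Math. Z. 298 (2021), Thm. 1
("`p = 2` … `ρ̄` is modular, `ρ̄` has non-solvable image ⟹ `ρ` is modular"), the residual
modularity being Serre's conjecture (Khare–Wintenberger 2009 with Kisin 2009).

State of line `Sketch` (idea `serre-avatar-modus-ponens`):

* the line's ONE proof obligation `stub_dyadicNonsolvableFM_of_facts : TungFact → KW₂ → crux`
  is LANDED (p144785, `Summits/Langlands/Langlands/Theorems/DyadicOddResidueDyadicNonsolvableFM.lean`,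
  decl `Summit.Langlands.Langlands.Theorems.stub_dyadicNonsolvableFM_of_facts`, with the deciding
  conditional theorem `dyadicNonsolvableFM_of_Tung2020` and the helpers
  `exists_cuspidal_satakeFrobCompatible_of_tateTwistNewform` (newform → `L`-algebraic `π` with a
  Tate twist absorbed, any prime), `isOpen_ker_residualRepChosen`, `exists_discreteModel_residualRep`
  (the Serre avatar of `ρ.residualRep`)); it is IMPORTED here, no longer a stub;
* the named fact `Literature.NumberTheory.Automorphic.Tung2020_fontaineMazurGL2_two_tateTwist`
  is LANDED as a Literature definition (p144531) and IMPORTED here (the revision-2 stand-in is gone);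
* REVISIONS 4–5 (this lead, c2): the second fact stub is WEAKENED from the strong form of Serre's
  conjecture at `2` (`stub_khare_wintenberger_two : ∀ k, khare_wintenberger 2 k`, level `N(ρ̄)` and
  weight `k(ρ̄)`) to its WEAK form `stub_serreWeak_two : ∀ k, exists_newform_of_odd_irreducible`
  at `p = 2` (some level, some weight) — which is, clause for clause, the residual-modularity
  hypothesis (RM) of the Tung fact; the new proof obligation
  `stub_dyadicNonsolvableFM_of_serreWeak : TungFact → WeakSerre₂ → crux` is LANDED (p165263, appended
  to `Theorems/DyadicOddResidueDyadicNonsolvableFM.lean` with the deciding conditional theorem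
  `dyadicNonsolvableFM_of_Tung2020_of_serreWeak` and `serreWeak_two_of_khare_wintenberger_two`) and is
  IMPORTED here (revision 5), no longer a stub; `serreWeak_two_of_strong` (proved here) records that
  the old stub implies the new one;
* the two fact stubs are NAMED FACTS (D-0014): discharging them means formalising Tung 2021
  (2-adic patching + `p`-adic local Langlands for `GL₂(ℚ₂)`) and Khare–Wintenberger 2009 +
  Kisin 2009 (Serre's conjecture, of which only the weak form at `2` is now owed) — both XL; they
  are registered so the harness sees exactly what the crux owes.

CONDITIONAL result: trust base {`Tung2020_fontaineMazurGL2_two_tateTwist`,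
`exists_newform_of_odd_irreducible` at `p = 2`} (the latter implied by `khare_wintenberger 2 ·`).
The composition `DyadicNonsolvableFM_of` concludes the route decl BY NAME; sorries only in
`stub_*` theorems; axioms otherwise `propext`, `Classical.choice`, `Quot.sound`.
-/

noncomputable section

open Literature.NumberTheory.Automorphic

namespace Summit.Langlands.Langlands.Theorems

set_option linter.dupNamespace false -- project-wide option; `Summit.Langlands.Langlands` is the mandated namespace

/-! ## Skeleton of line `Sketch`, revision 5: fact stubs `stub_Tung2020_fontaineMazurGL2_two_tateTwist`,
## `stub_serreWeak_two` (weak Serre at `2`); the proof obligation `stub_dyadicNonsolvableFM_of_serreWeak`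
## is the landed theorem (p165263, imported). -/

/-- STUB = NAMED FACT (Tung 2020, Thm. 1; Literature fact ACCEPTED p144531,
`Literature.NumberTheory.Automorphic.Tung2020_fontaineMazurGL2_two_tateTwist`). Not a proof
obligation of the line: discharging it is formalising 2-adic patching + `p`-adic local Langlands
for `GL₂(ℚ₂)` (XL). [cite: Tung2020, Thm. 1] -/
theorem stub_Tung2020_fontaineMazurGL2_two_tateTwist : Tung2020_fontaineMazurGL2_two_tateTwist := by
  sorry

/-- STUB = NAMED FACT (Serre's conjecture at `p = 2`, WEAK form (3.2.3): some level, some weight;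
in-tree `exists_newform_of_odd_irreducible` at `p = 2`; Khare–Wintenberger 2009 Thm. 1.2/9.1 with
Kisin 2009 prove the strong form `khare_wintenberger 2 k`, which implies it by the proved
`exists_newform_of_odd_irreducible_of_khare_wintenberger`).  Revision 4 WEAKENS the earlier stub
`stub_khare_wintenberger_two` (strong form) to exactly the shape of Tung's hypothesis (RM).  Not a
proof obligation of the line (XL: Serre's conjecture).
[cite: KhareWintenberger2009, Thm. 1.2 and Thm. 9.1 (with Serre, Duke Math. J. 54 (1987), (3.2.3))] -/
theorem stub_serreWeak_two :
    ∀ (k : Type) [Field k] [TopologicalSpace k] [DiscreteTopology k],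
      @exists_newform_of_odd_irreducible 2 k _ _ _ := by
  sorry

/-- Sanity link (proved, no sorry of its own): the revision-3 stub `stub_khare_wintenberger_two`
(strong form) implies the revision-4/5 stub `stub_serreWeak_two` (weak form), so the reshape only
WEAKENS what the crux owes. [cite: KhareWintenberger2009, Thm. 1.2 and Thm. 9.1] -/
theorem serreWeak_two_of_strong
    (hKW : ∀ (k : Type) [Field k] [TopologicalSpace k] [DiscreteTopology k],
      khare_wintenberger 2 k) :
    ∀ (k : Type) [Field k] [TopologicalSpace k] [DiscreteTopology k],
      @exists_newform_of_odd_irreducible 2 k _ _ _ :=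
  fun k _ _ _ => exists_newform_of_odd_irreducible_of_khare_wintenberger 2 k (hKW k)

/-- **The composition** (revision 5): the crux BY NAME from the landed proof obligation
`stub_dyadicNonsolvableFM_of_serreWeak` (p165263) and the two fact stubs. [folklore] -/
theorem DyadicNonsolvableFM_of :
    Summit.Langlands.Langlands.Theses.DyadicOddResidue.DyadicNonsolvableFM :=
  stub_dyadicNonsolvableFM_of_serreWeak stub_Tung2020_fontaineMazurGL2_two_tateTwist
    stub_serreWeak_two

end Summit.Langlands.Langlands.Theorems

end
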